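import Summits.ResolutionOfSingularities.ResolutionOfSingularities.Theorems.FrobeniusLadderFInjectiveMacaulayficationEmbeddedSncCartier
import Summits.ResolutionOfSingularities.ResolutionOfSingularities.Theorems.FrobeniusLadderFInjectiveMacaulayficationGDDOfIsolatedDimLeThree
import Summits.ResolutionOfSingularities.ResolutionOfSingularities.Theorems.FrobeniusLadderFInjectiveMacaulayficationRegularBlowupModelSupported
import Summits.ResolutionOfSingularities.ResolutionOfSingularities.Theorems.FrobeniusLadderFInjectiveMacaulayficationNormalAffineNeighbourhood
import Literature.AlgebraicGeometry.Resolution.TransversalHasSNCWith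
import Literature.AlgebraicGeometry.Resolution.BlowupsFlatBaseChange
import Literature.AlgebraicGeometry.Resolution.AlterationsBoundarySmoothLocus
import Literature.AlgebraicGeometry.Resolution.GenericPointStalkData
import Literature.AlgebraicGeometry.Resolution.NormalSurfaceSingularLocus
import Literature.AlgebraicGeometry.Resolution.ExcellentRingsFieldProofs
import Literature.AlgebraicGeometry.Resolution.QuasiExcellentLocalization
import Literature.AlgebraicGeometry.Resolution.GeneralLU
import Literature.AlgebraicGeometry.Resolution.GeneralLUProofs
import Mathlib.RingTheory.Localization.LocalizationLocalization
import Mathlib.AlgebraicGeometry.FunctionField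
import HarnessLib

/-!
# The surface rung of ThmD-≤3 from COR D1 + Lipman ALONE, in blow-up form (no anti-ample ℚ-divisor step); GDD at regular points
# (crux `FInjectiveMacaulayfication` stmt-ResolutionOfSingularities-15315, chain w45a; task (C‴) pieces (2)(3))

[OURS · L1 W4.5a · res-L1-w45a-lead-1] Helper theorems toward the residual-class census (ThmD-≤3, THEOREM-D programme of
res-L1-w45a-idea-1 / strat-1); NOT door rungs, NOT statements of any manuscript; AI-written, weaker than expert review.  KNOWN compositions
modulo COR D1 `hD` BY TEXT (idea-1's `gdd_of_sncBlowupModel`) and the printed facts BY NAME (`Lipman1978SequenceFinite`,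
`CossartJannsenSaito2020EmbeddedSequenceB`; S-V inside `RegularBlowupModelSupported` is a tree theorem).

THE POINT.  Idea-1's plan for the surface rung `gdd_of_normalSurfacePoint` runs through THEOREM D's (S2): the minimal good resolution
carries a `π`-anti-ample `ℚ`-divisor `−B` (negative definiteness, Kollár–Mori 3.40).  In COR D1's currency (S2) IS «`π` is the blowing up of
an `𝔪`-supported ideal sheaf», and the tree ALREADY has Lipman in exactly that form:
`RegularBlowupModelSupported.exists_regular_isBlowup_supported_of_lipman` (W2/T2 engine of res-L1-w45a-stub-4).  So the surface rung is a
composition with the SAME skeleton as (C) (`GDDOfIsolatedDimThree`), Cossart–Piltant ↦ Lipman, principalization ↦ «the exceptional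
divisor of a blowing up is Cartier» (`EmbeddedSncCartier`, p56xxxx):

* `gdd_of_isRegularLocalRing_of (hD)` — a REGULAR local `A` (normal Noetherian local domain of char `p`, `𝔪 ≠ 0`, Spec regular off `𝔪`) has
  GDD: blow up the reduced closed point (a regular centre transversal to the empty divisor), so `X′` is regular with snc exceptional divisor
  (`IsTransversalWith.isStrictNormalCrossingsDivisor_preimage_of_isBlowup`), and apply `hD`.  The degenerate branch of every dimension.
* `gdd_of_normalSurfacePoint_of (hD) (hL) (hCJS)` — idea-1's `gdd_of_normalSurfacePoint hL` WITH THE SAME BINDERS, now a composition: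
  `S` a finite-type domain over `k`, `𝔭` maximal, `A = S_𝔭` normal of dimension `2` ⇒ `GDD p A`.  Proof: `A_𝔔` is regular for `𝔔 ≠ 𝔪`
  (normal of dimension ≤ 1); if `A` is regular, the previous theorem; else take a normal affine neighbourhood `U ∋ 𝔭` of `Spec S`
  (`NormalAffineNeighbourhood.exists_normal_affineOpen`, a `NormalSurface k`), Lipman's ONE blowing up `π : Y → U` along `J ≠ 0`,
  `Supp J ⊆ Sing U`, `Y` regular; pull it back along the flat preimmersion `φ : Spec A → U` (`Spec` of `𝒪_{U,𝔭} ≅ A` followed by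
  `U.fromSpecStalk`): `ρ₁ : T → Spec A` is the blowing up along `J′ = Jφ` (`IsBlowup.pullback_snd_of_flat`), `T` regular
  (`mem_regularLocus_iff_of_flat_of_isPreimmersion`), `Supp J′ = {𝔪}` (off `𝔪` the points of `Spec A` are regular, so not under `Supp J`;
  `𝔪 ∈ Supp J′` because `A` is not regular); the exceptional divisor `K = J′𝒪_T` is effective Cartier with support `ρ₁⁻¹{𝔪}` of dimension
  `≤ 2`, so `EmbeddedSncCartier.embeddedSnc_of_cartierSupport hCJS` gives `ρ₂ : X′ → T`, one blowing up supported in `ρ₁⁻¹{𝔪}`, `X′` regular,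
  `ρ₂⁻¹ρ₁⁻¹{𝔪}` snc; `ρ₂ ≫ ρ₁` is one `𝔪`-supported blowing up (`IsBlowup.exists_isBlowup_comp_supported`); `hD`.
-/

-- single-problem summit: the doubled namespace component is forced
set_option linter.dupNamespace false
set_option autoImplicit false

noncomputable section

open CategoryTheory CategoryTheory.Limits AlgebraicGeometry TopologicalSpace IsLocalRing
open Literature.AlgebraicGeometry.Resolution Literature.AlgebraicGeometry.CossartPiltant200819
open Literature.AlgebraicGeometry.CossartPiltant200819.CP2019
open Scheme.IdealSheafData

namespace Summit.ResolutionOfSingularities.ResolutionOfSingularities.Theorems.FInjectiveMacaulayfication.GDDDimTwoOfLipman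

open Summit.ResolutionOfSingularities.ResolutionOfSingularities.Theorems.FInjectiveMacaulayfication
open Summit.ResolutionOfSingularities.ResolutionOfSingularities.Theorems.FInjectiveMacaulayfication.GDD

/-! ## §1 Regular local rings, via COR D1 -/

/-- A local ring is its own localisation at the maximal ideal: `A ≃+* A_𝔪`. [folklore] -/
theorem isRegularLocalRing_iff_atPrime_maximalIdeal (A : Type) [CommRing A] [IsLocalRing A] :
    IsRegularLocalRing A ↔ IsRegularLocalRing (Localization.AtPrime (maximalIdeal A)) := by
  let e : A ≃ₐ[A] Localization.AtPrime (maximalIdeal A) :=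
    IsLocalization.atUnits A (maximalIdeal A).primeCompl fun y hy => IsLocalRing.notMem_maximalIdeal.mp hy
  exact ⟨fun h => IsRegularLocalRing.of_ringEquiv e.toRingEquiv, fun h => IsRegularLocalRing.of_ringEquiv e.toRingEquiv.symm⟩

/-- `Spec A` is regular when `A` is a regular local ring and `A_𝔮` is regular for every prime `𝔮 ≠ 𝔪`. [folklore] -/
theorem isRegular_Spec_of (A : Type) [CommRing A] [IsLocalRing A] (hreg : IsRegularLocalRing A)
    (hiso : ∀ (𝔮 : Ideal A) [𝔮.IsPrime], 𝔮 ≠ maximalIdeal A → IsRegularLocalRing (Localization.AtPrime 𝔮)) :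
    Scheme.IsRegular (Spec (.of A)) := by
  intro x
  apply (Scheme.mem_regularLocus x).mp
  rw [regularLocus_Spec_eq, Set.mem_setOf_eq]
  by_cases hx : x.asIdeal = maximalIdeal A
  · have hx' : x = IsLocalRing.closedPoint A := PrimeSpectrum.ext hx
    subst hx'
    exact (isRegularLocalRing_iff_atPrime_maximalIdeal A).mp hreg
  · exact hiso x.asIdeal hx

/-- **GDD at a REGULAR point, from COR D1.**  A Noetherian integrally closed local domain `A` of characteristic `p` which is a regular local
ring, with `𝔪 ≠ 0` and `A_𝔮` regular for all primes `𝔮 ≠ 𝔪`, has GDD — given BY TEXT COR D1 `hD` (idea-1's `gdd_of_sncBlowupModel`):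
blow up the reduced closed point `{𝔪} ⊆ Spec A` (`π : X′ → Spec A`, `Scheme.IdealSheafData.vanishingIdeal`); `{𝔪}` is transversal to the
empty divisor (a regular system of parameters of `𝒪_{Spec A,𝔪}` cuts it out), so `X′` is regular and `π⁻¹{𝔪}` is a strict normal crossings
divisor (`IsTransversalWith.isStrictNormalCrossingsDivisor_preimage_of_isBlowup`); then `hD`.  [OURS · L1 W4.5a helper; KNOWN modulo `hD`] -/
theorem gdd_of_isRegularLocalRing_of
    (hD : ∀ (p : ℕ) [Fact p.Prime] (A : Type) [CommRing A] [IsDomain A] [IsNoetherianRing A] [IsLocalRing A] [IsIntegrallyClosed A]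
        [CharP A p] (X' : Scheme.{0}) (π : X' ⟶ Spec (.of A)) (𝓛 : (Spec (.of A)).IdealSheafData),
        𝓛 ≠ ⊥ → (𝓛.support : Set (Spec (.of A))) ⊆ {IsLocalRing.closedPoint A} → IsBlowup π 𝓛 → Scheme.IsRegular X' →
        IsStrictNormalCrossingsDivisor X' (π ⁻¹' {IsLocalRing.closedPoint A}) → GDD p A)
    (p : ℕ) [Fact p.Prime] (A : Type) [CommRing A] [IsDomain A] [hreg : IsRegularLocalRing A] [IsIntegrallyClosed A]
    [CharP A p] (hiso : ∀ (𝔮 : Ideal A) [𝔮.IsPrime], 𝔮 ≠ maximalIdeal A → IsRegularLocalRing (Localization.AtPrime 𝔮))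
    (hm : maximalIdeal A ≠ ⊥) : GDD p A := by
  classical
  set X : Scheme.{0} := Spec (.of A) with hXdef
  have hXreg : Scheme.IsRegular X := isRegular_Spec_of A hreg hiso
  have hc : IsClosed ({IsLocalRing.closedPoint A} : Set X) :=
    (PrimeSpectrum.isClosed_singleton_iff_isMaximal _).mpr (IsLocalRing.maximalIdeal.isMaximal A)
  set T : Closeds X := ⟨{IsLocalRing.closedPoint A}, hc⟩ with hTdef
  -- the blowing up of the reduced closed point
  obtain ⟨X', π, hπ⟩ := exists_isBlowup X (vanishingIdeal T)
  -- `{𝔪}` is transversal to the empty divisor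
  have hDB : IsTransversalWith X ({IsLocalRing.closedPoint A} : Set X) (∅ : Set X) := by
    intro x hx
    have hx' : x = IsLocalRing.closedPoint A := hx
    subst hx'
    haveI : IsRegularLocalRing (X.presheaf.stalk (IsLocalRing.closedPoint A)) := hXreg _
    obtain ⟨s, hs, hspan⟩ := Submodule.FG.exists_span_finset_card_eq_spanFinrank
      (IsNoetherian.noetherian (maximalIdeal (X.presheaf.stalk (IsLocalRing.closedPoint A))))
    let z : Fin s.card → X.presheaf.stalk (IsLocalRing.closedPoint A) := fun i => (s.equivFin.symm i : _)
    have hrange : Set.range z = (s : Set _) := by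
      ext a
      constructor
      · rintro ⟨i, rfl⟩
        exact (s.equivFin.symm i).2
      · intro ha
        exact ⟨s.equivFin ⟨a, ha⟩, by simp [z]⟩
    have hz : Ideal.span (Set.range z) = maximalIdeal (X.presheaf.stalk (IsLocalRing.closedPoint A)) := by
      rw [hrange]; exact hspan
    refine ⟨hXreg _, s.card, 0, z, fun i => i.elim0, ∅, ?_, ?_, ?_, ?_⟩
    · have h1 := IsRegularLocalRing.spanFinrank_maximalIdeal (R := X.presheaf.stalk (IsLocalRing.closedPoint A))
      rw [← hs] at h1
      rw [← h1, Nat.add_zero]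
    · rw [Set.range_eq_empty (fun i : Fin 0 => (i.elim0 : X.presheaf.stalk (IsLocalRing.closedPoint A))), Set.union_empty, hz]
    · rw [stalkIdeal_vanishingIdeal_eq_maximalIdeal_of_closure_eq rfl, hz]
    · rw [Finset.prod_empty, Ideal.span_singleton_one]
      apply stalkIdeal_eq_top_of_not_mem_support
      rw [← SetLike.mem_coe, Scheme.IdealSheafData.coe_support_vanishingIdeal]
      change IsLocalRing.closedPoint A ∉ closure (∅ : Set X)
      rw [closure_empty]
      exact Set.notMem_empty _
  obtain ⟨hX'reg, hsnc⟩ := hDB.isStrictNormalCrossingsDivisor_preimage_of_isBlowup hXreg hc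
    (IsStrictNormalCrossingsDivisor.empty X) hπ
  rw [Set.union_empty] at hsnc
  have hsupp : ((vanishingIdeal T).support : Set X) = {IsLocalRing.closedPoint A} :=
    Scheme.IdealSheafData.coe_support_vanishingIdeal T
  have hne : vanishingIdeal T ≠ ⊥ := by
    intro h0
    have hmem : genericPoint X ∈ ((vanishingIdeal T).support : Set X) := by rw [h0, support_bot]; trivial
    rw [hsupp] at hmem
    exact GDDOfIsolatedDimLeThree.genericPoint_ne_closedPoint_of_ne_bot A hm hmem
  exact hD p A X' π _ hne hsupp.le hπ hX'reg hsnc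

/-! ## §2 The surface rung from COR D1 + Lipman -/

/-- **The surface rung of ThmD-≤3 from COR D1 + Lipman, in blow-up form** (= idea-1's `gdd_of_normalSurfacePoint hL`, same binders): `S` a
finite-type domain over a field `k` of characteristic `p`, `𝔭 ⊆ S` maximal with `S_𝔭` normal of dimension `2` ⇒ `GDD p S_𝔭`, given BY TEXT
COR D1 `hD` and BY NAME `Lipman1978SequenceFinite`, `CossartJannsenSaito2020EmbeddedSequenceB`.  Route in the module docstring (normal
affine neighbourhood → Lipman's `𝔪`-supported regular blowing up → flat pull-back to `Spec S_𝔭` → `EmbeddedSncCartier` on the exceptional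
divisor → one composite `𝔪`-supported blowing up → `hD`; the regular case by `gdd_of_isRegularLocalRing_of`).  No negative-definiteness,
no anti-ample `ℚ`-divisor.  [OURS · L1 W4.5a helper toward ThmD-≤3; KNOWN composition modulo `hD`; cite: Liu2002, Thm. 8.3.44;
CossartJannsenSaito2020, Thm. 1.4; GortzWedhorn2020, Prop. 13.91] -/
theorem gdd_of_normalSurfacePoint_of
    (hD : ∀ (p : ℕ) [Fact p.Prime] (A : Type) [CommRing A] [IsDomain A] [IsNoetherianRing A] [IsLocalRing A] [IsIntegrallyClosed A]
        [CharP A p] (X' : Scheme.{0}) (π : X' ⟶ Spec (.of A)) (𝓛 : (Spec (.of A)).IdealSheafData),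
        𝓛 ≠ ⊥ → (𝓛.support : Set (Spec (.of A))) ⊆ {IsLocalRing.closedPoint A} → IsBlowup π 𝓛 → Scheme.IsRegular X' →
        IsStrictNormalCrossingsDivisor X' (π ⁻¹' {IsLocalRing.closedPoint A}) → GDD p A)
    (hL : Lipman1978SequenceFinite.{0}) (hCJS : CossartJannsenSaito2020EmbeddedSequenceB.{0})
    (p : ℕ) [Fact p.Prime] (k : Type) [Field k] [CharP k p]
    (S : Type) [CommRing S] [IsDomain S] [Algebra k S] [Algebra.FiniteType k S]
    (𝔭 : Ideal S) [𝔭.IsMaximal] [IsIntegrallyClosed (Localization.AtPrime 𝔭)]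
    (hdim : ringKrullDim (Localization.AtPrime 𝔭) = (2 : ℕ)) :
    GDD p (Localization.AtPrime 𝔭) := by
  classical
  -- `A = S_𝔭`: a normal Noetherian local domain of characteristic `p` and dimension `2`, regular off `𝔪`
  haveI : IsNoetherianRing S := Algebra.FiniteType.isNoetherianRing k S
  haveI : IsNoetherianRing (Localization.AtPrime 𝔭) := IsLocalization.isNoetherianRing 𝔭.primeCompl _ inferInstance
  haveI : CharP (Localization.AtPrime 𝔭) p :=
    charP_of_injective_algebraMap (algebraMap k (Localization.AtPrime 𝔭)).injective p
  have hm2 : (maximalIdeal (Localization.AtPrime 𝔭)).height = 2 := by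
    apply WithBot.coe_injective
    rw [IsLocalRing.maximalIdeal_height_eq_ringKrullDim, hdim]
    norm_cast
  have hm0 : maximalIdeal (Localization.AtPrime 𝔭) ≠ ⊥ := by
    intro h
    have h0 := ringKrullDim_eq_zero_of_isField (IsLocalRing.isField_iff_maximalIdeal_eq.mpr h)
    rw [hdim] at h0
    exact absurd h0 (by norm_num)
  have hreg_off : ∀ (𝔔 : Ideal (Localization.AtPrime 𝔭)) [𝔔.IsPrime], 𝔔 ≠ maximalIdeal (Localization.AtPrime 𝔭) →
      IsRegularLocalRing (Localization.AtPrime 𝔔) := by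
    intro 𝔔 _ hne
    haveI : IsIntegrallyClosed (Localization.AtPrime 𝔔) :=
      isIntegrallyClosed_of_isLocalization _ 𝔔.primeCompl 𝔔.primeCompl_le_nonZeroDivisors
    apply isRegularLocalRing_of_isIntegrallyClosed_of_ringKrullDim_le_one
    have hlt : 𝔔 < maximalIdeal (Localization.AtPrime 𝔭) :=
      lt_of_le_of_ne (IsLocalRing.le_maximalIdeal (Ideal.IsPrime.ne_top inferInstance)) hne
    have hh := Ideal.height_strict_mono_of_isPrime hlt
    rw [hm2] at hh
    obtain ⟨n, hn⟩ := ENat.ne_top_iff_exists.mp (𝔔.height_ne_top (Ideal.IsPrime.ne_top inferInstance))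
    rw [← hn] at hh
    have hn1 : n ≤ 1 := by
      have : n < 2 := by exact_mod_cast hh
      omega
    rw [IsLocalization.AtPrime.ringKrullDim_eq_height 𝔔 (Localization.AtPrime 𝔔), ← hn]
    exact_mod_cast hn1
  -- the regular case
  by_cases hA : IsRegularLocalRing (Localization.AtPrime 𝔭)
  · haveI := hA
    exact gdd_of_isRegularLocalRing_of hD p (Localization.AtPrime 𝔭) hreg_off hm0
  -- the affine model `X₁ = Spec S` over `k`, its point `b = 𝔭`, `𝒪_{X₁,b} ≅ A`
  set A : Type := Localization.AtPrime 𝔭 with hAdef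
  set X₁ : Scheme.{0} := Spec (.of S) with hX₁def
  let f₁ : X₁ ⟶ Spec (.of k) := Spec.map (CommRingCat.ofHom (algebraMap k S))
  haveI : LocallyOfFiniteType f₁ :=
    (HasRingHomProperty.Spec_iff (P := @LocallyOfFiniteType)).mpr (RingHom.finiteType_algebraMap.mpr ‹_›)
  let b : X₁ := ⟨𝔭, inferInstance⟩
  letI : Algebra S (X₁.presheaf.stalk b) := (StructureSheaf.toStalk S b).hom.toAlgebra
  haveI : IsLocalization.AtPrime (X₁.presheaf.stalk b) 𝔭 := StructureSheaf.IsLocalization.to_stalk S b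
  let e₁ : A ≃ₐ[S] X₁.presheaf.stalk b := IsLocalization.algEquiv 𝔭.primeCompl _ _
  have hnorm : IsIntegrallyClosed (X₁.presheaf.stalk b) := IsIntegrallyClosed.of_equiv e₁.toRingEquiv
  -- a normal affine neighbourhood, a normal surface
  obtain ⟨U, hU, hbU, -, hUn⟩ := NormalAffineNeighbourhood.exists_normal_affineOpen X₁ f₁ b hnorm
  let b' : (U : Scheme.{0}) := ⟨b, hbU⟩
  let eb : (X₁.presheaf.stalk b) ≃+* ((U : Scheme.{0}).presheaf.stalk b') :=
    (asIso (U.ι.stalkMap b')).commRingCatIsoToRingEquiv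
  haveI : IsAffine (U : Scheme.{0}) := hU
  haveI : Nonempty (U : Scheme.{0}) := ⟨b'⟩
  haveI : IsIntegral (U : Scheme.{0}) := isIntegral_of_isOpenImmersion U.ι
  haveI : QuasiCompact (U.ι ≫ f₁) := (HasAffineProperty.iff_of_isAffine (P := @QuasiCompact)).mpr inferInstance
  have hbcl : IsClosed ({b} : Set X₁) := (PrimeSpectrum.isClosed_singleton_iff_isMaximal _).mpr ‹_›
  have hb'cl : IsClosed ({b'} : Set (U : Scheme.{0})) := by
    have h := hbcl.preimage U.ι.continuous
    have hset : (U.ι.base ⁻¹' {b} : Set (U : Scheme.{0})) = {b'} := by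
      ext u
      simp only [Set.mem_preimage, Set.mem_singleton_iff]
      constructor
      · intro hu; exact Subtype.ext hu
      · intro hu; rw [hu]; rfl
    rw [hset] at h
    exact h
  let e : A ≃+* (U : Scheme.{0}).presheaf.stalk b' := e₁.toRingEquiv.trans eb
  have hdimU : topologicalKrullDim (U : Scheme.{0}) = 2 := by
    rw [← ringKrullDim_stalk_eq_of_isClosed (U.ι ≫ f₁) hb'cl, ← ringKrullDim_eq_of_ringEquiv e, hdim]
    rfl
  let N : NormalSurface k :=
    { X := U, hom := U.ι ≫ f₁, isSeparated := inferInstance, locallyOfFiniteType := inferInstance,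
      quasiCompact := inferInstance, isIntegral := inferInstance,
      normal := fun u => by
        haveI := hUn (U.ι.base u) u.2
        exact IsIntegrallyClosed.of_equiv (asIso (U.ι.stalkMap u)).commRingCatIsoToRingEquiv
      dim_eq := hdimU }
  -- Lipman: one `Sing`-supported regular blowing up of `U`
  obtain ⟨Y, _, π, J, hJne, hπ, hJsupp, hYreg⟩ := RegularBlowupModelSupported.exists_regular_isBlowup_supported_of_lipman hL N
  -- the flat preimmersion `φ : Spec A → U`
  let ι₀ : (U : Scheme.{0}).presheaf.stalk b' ⟶ CommRingCat.of A := CommRingCat.ofHom e.symm.toRingHom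
  haveI : IsIso ι₀ := by
    refine ⟨⟨CommRingCat.ofHom e.toRingHom, ?_, ?_⟩⟩
    · ext x; exact e.apply_symm_apply x
    · ext x; exact e.symm_apply_apply x
  let φ : Spec (.of A) ⟶ (U : Scheme.{0}) := Spec.map ι₀ ≫ (U : Scheme.{0}).fromSpecStalk b'
  haveI : Flat ((U : Scheme.{0}).fromSpecStalk b') := flat_fromSpecStalk _ _
  haveI : Flat φ := inferInstance
  haveI : IsPreimmersion φ := inferInstance
  -- pull back: `ρ₁ : T → Spec A` is the blowing up along `J′ = Jφ`, `T` regular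
  set J' : (Spec (.of A)).IdealSheafData := J.comap φ with hJ'def
  have hρ₁ : IsBlowup (pullback.snd π φ) J' := hπ.pullback_snd_of_flat φ
  have hTreg : Scheme.IsRegular (pullback π φ) := fun t =>
    (Scheme.mem_regularLocus t).mp ((mem_regularLocus_iff_of_flat_of_isPreimmersion (pullback.fst π φ) t).mpr
      (by rw [hYreg.regularLocus_eq_univ]; trivial))
  have hXreg_off : ∀ q : Spec (.of A), q ≠ IsLocalRing.closedPoint A → q ∈ Scheme.regularLocus (Spec (.of A)) := by
    intro q hq
    rw [regularLocus_Spec_eq]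
    exact hreg_off q.asIdeal fun h => hq (PrimeSpectrum.ext h)
  -- `Supp J′ = {𝔪}`
  have hJ'supp : (J'.support : Set (Spec (.of A))) ⊆ {IsLocalRing.closedPoint A} := by
    intro q hq
    by_contra hne
    have hq' : φ q ∈ (J.support : Set (U : Scheme.{0})) := by
      rw [hJ'def, support_comap] at hq
      exact hq
    exact hJsupp hq' ((mem_regularLocus_iff_of_flat_of_isPreimmersion φ q).mp (hXreg_off q hne))
  have hmJ' : IsLocalRing.closedPoint A ∈ (J'.support : Set (Spec (.of A))) := by
    by_contra hm'
    apply hA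
    let W : (Spec (.of A)).Opens := ⟨(J'.support : Set (Spec (.of A)))ᶜ, J'.support.isClosed.isOpen_compl⟩
    haveI : IsIso (pullback.snd π φ ∣_ W) := hρ₁.isIso_compl
    obtain ⟨z, hz⟩ := (ConcreteCategory.bijective_of_isIso (pullback.snd π φ ∣_ W).base).2 ⟨IsLocalRing.closedPoint A, hm'⟩
    have hzx : (pullback.snd π φ) z.1 = IsLocalRing.closedPoint A := by
      have h1 := congrArg Subtype.val hz
      rwa [morphismRestrict_base_coe] at h1
    have hzreg : z.1 ∈ Scheme.regularLocus (pullback π φ) := by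
      rw [hTreg.regularLocus_eq_univ]; trivial
    have hcreg := (mem_regularLocus_iff_of_isIso_morphismRestrict (pullback.snd π φ) W z.1 z.2).mp hzreg
    rw [hzx, regularLocus_Spec_eq, Set.mem_setOf_eq] at hcreg
    exact (isRegularLocalRing_iff_atPrime_maximalIdeal A).mpr hcreg
  have hJ'eq : (J'.support : Set (Spec (.of A))) = {IsLocalRing.closedPoint A} :=
    Set.Subset.antisymm hJ'supp (Set.singleton_subset_iff.mpr hmJ')
  have hJ'ne : J' ≠ ⊥ := by
    intro h0
    have hmem : genericPoint (Spec (.of A)) ∈ (J'.support : Set (Spec (.of A))) := by rw [h0, support_bot]; trivial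
    rw [hJ'eq] at hmem
    exact GDDOfIsolatedDimLeThree.genericPoint_ne_closedPoint_of_ne_bot A hm0 hmem
  -- `T` integral Noetherian regular excellent of dimension `2`
  haveI : IsIntegral (pullback π φ) := hρ₁.isIntegral hJ'ne
  haveI : IsProper (pullback.snd π φ) := hρ₁.isProper
  haveI : IsNoetherian (pullback π φ) := by
    haveI : IsLocallyNoetherian (pullback π φ) := LocallyOfFiniteType.isLocallyNoetherian (pullback.snd π φ)
    haveI : CompactSpace ↥(pullback π φ) := QuasiCompact.compactSpace_of_compactSpace (pullback.snd π φ)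
    exact {}
  have hqe : Scheme.IsQuasiExcellent (Spec (.of A)) :=
    Scheme.isQuasiExcellent_of_locallyOfFiniteType_of_isQuasiExcellentRing Stacks07QU_holds
      (isQuasiExcellentRing_of_isLocalization 𝔭.primeCompl (isQuasiExcellentRing_of_finiteType_field k S)) (𝟙 _)
  have hTexc : Scheme.IsExcellent (pullback π φ) :=
    isExcellent_of_isRegular_of_isQuasiExcellent hTreg (Scheme.IsQuasiExcellent.of_locallyOfFiniteType (pullback.snd π φ) hqe)
  -- the exceptional divisor `K = J′𝒪_T`: effective Cartier, support `ρ₁⁻¹{𝔪}` of dimension `≤ 2`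
  have hK : IsEffectiveCartier (J'.comap (pullback.snd π φ)) := hρ₁.isEffectiveCartier
  have hKsupp : ((J'.comap (pullback.snd π φ)).support : Set ↥(pullback π φ)) = (pullback.snd π φ) ⁻¹' {IsLocalRing.closedPoint A} := by
    rw [support_comap, Closeds.coe_preimage, hJ'eq]
  have hdimX : topologicalKrullDim ↥(Spec (.of A)) = 2 := by
    have h := PrimeSpectrum.topologicalKrullDim_eq_ringKrullDim (R := A)
    rw [hdim] at h
    exact_mod_cast h
  have hdimT : topologicalKrullDim ↥(pullback π φ) = 2 :=
    (hρ₁.isBirational' hJ'ne).topologicalKrullDim_eq_of_isProper.trans hdimX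
  have hKdim : topologicalKrullDim ((J'.comap (pullback.snd π φ)).support : Set ↥(pullback π φ)) ≤ 2 := by
    rw [← hdimT]
    exact topologicalKrullDim_subspace_le _ _
  -- `EmbeddedSncCartier` on `T`, then compose
  obtain ⟨𝓛₂, X', ρ₂, -, h𝓛₂supp, hρ₂, hX'reg, hsnc⟩ :=
    EmbeddedSncCartier.embeddedSnc_of_cartierSupport hCJS (pullback π φ) hTreg hTexc _ hK hKdim
  have h𝓛₂supp' : (𝓛₂.support : Set ↥(pullback π φ)) ⊆ (pullback.snd π φ) ⁻¹' {IsLocalRing.closedPoint A} := by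
    rw [← hKsupp]
    exact h𝓛₂supp
  obtain ⟨𝓛, h𝓛, h𝓛supp⟩ :=
    IsBlowup.exists_isBlowup_comp_supported (pullback.snd π φ) J' ρ₂ 𝓛₂ {IsLocalRing.closedPoint A} hρ₁ hJ'supp hρ₂ h𝓛₂supp'
  have h𝓛ne : 𝓛 ≠ ⊥ := by
    intro h0
    have hmem : genericPoint (Spec (.of A)) ∈ (𝓛.support : Set (Spec (.of A))) := by rw [h0, support_bot]; trivial
    exact GDDOfIsolatedDimLeThree.genericPoint_ne_closedPoint_of_ne_bot A hm0 (h𝓛supp hmem)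
  have hpre : (ρ₂ ≫ pullback.snd π φ) ⁻¹' {IsLocalRing.closedPoint A} =
      ρ₂ ⁻¹' ((J'.comap (pullback.snd π φ)).support : Set ↥(pullback π φ)) := by
    rw [hKsupp]
    ext x
    simp only [Set.mem_preimage, Scheme.Hom.comp_apply]
  exact hD p A X' (ρ₂ ≫ pullback.snd π φ) 𝓛 h𝓛ne h𝓛supp h𝓛 hX'reg (hpre ▸ hsnc)

end Summit.ResolutionOfSingularities.ResolutionOfSingularities.Theorems.FInjectiveMacaulayfication.GDDDimTwoOfLipman

end
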